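import Summits.QuantumAdvantage.QuantumAdvantage.Theorems.ArithStatLadderIqThreeMemBQPRealTrial
import Summits.QuantumAdvantage.QuantumAdvantage.Theorems.ArithStatLadderIqThreeMemBQPRealCount
import Summits.QuantumAdvantage.QuantumAdvantage.Theorems.ArithStatLadderIqThreeMemBQPOrderBitLanguage
import Literature.Computability.Cryptography.OneSidedTrialsPromiseBQP
import Literature.Computability.Cryptography.HallgrenClassGroup
import Literature.NumberTheory.QuadraticFields.ScholzMirrorTorsionWitnessTools
import Literature.NumberTheory.QuadraticFields.ThreeTorsion
import Literature.NumberTheory.QuadraticFields.RealQuadraticRegulator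
import Literature.GroupTheory.FiniteAbelian.TorsionWitnessStatistic
import Literature.Computability.Complexity.TM2PassThrough
import Literature.Computability.Complexity.GoldwasserSipserAssembly
import Mathlib.NumberTheory.NumberField.DedekindZeta
import Mathlib.NumberTheory.NumberField.Units.Regulator
import HarnessLib

/-!
# Crux `ArithStatLadder.IqThreeMemBQP` (stmt-QuantumAdvantage-2424), line `scholz-mirror-siegel` — stub `stub_realWitnessOfParts` (S6b)

Registered stub of the line skeleton `Cruxes/IqThreeMemBQP/Lines/scholz_mirror_siegel.lean` (reshape r5:
the signature below is stated over tree constants only and must stay BYTE-IDENTICAL to the registered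
one — edit only the proof and add helper lemmas above it; adjust the imports freely).

Proof summary (Route B, the reduced-ideal sampler as ONE-SIDED TRIALS, `mem_PromiseBQP_of_oneSided_trials`).
`D = D⁺(d)`, `d₀ = mirrorRadicand d` (`fundDiscr d₀ = D`, `mirrorRadicand_spec`), `F` the real quadratic field of
discriminant `D` (`exists_numberField_discr_eq_mirrorDisc`), `α² = d₀` (`exists_ringOfIntegers_sq_eq`). Trial
language `T = {⟨x, z⟩ | tq x z ∈ L₅} ∈ BQP`: `tq` is the trial program of `…RealTrial` (`trial_exists`: coins
`(b, j)`, factor `M_b = (D − b²)/4` through Shor's bit-graph, `a` = `j`-th divisor, query `⟨d₀, fmtA, fmtR⟩`),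
`L₅ = VALID ∩ YES ∈ BQP` the guarded order-bit language of `…OrderBitLanguage` (`orderBitLang_mem_BQP`, from
`(S5)` by the validity selector and the oracle wrap `…SelectorWrap`). No side: a hit would be a class of `F` of
order divisible by `3`, impossible when `#Cl(F)[3] = 1` (`not_three_dvd_orderOf_of_torsion_eq_one`). Yes side:
`(R1)` + `exists_goodPairs` (`…RealCount`: torsion statistic, `3 ∣ h_F`, divisor threshold) give
`≥ (2h_F/3)·R_F/log(2√D) − 2√D(1+log D)³/K'` reduced pairs with `3 ∣ ord` and `τ(M_b) ≤ K'²`, each hit by the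
coins spelling `(b, j(a,b))` (`coin_injection`; validity by `fmt_valid`, membership by `mem_yes_iff`); with
`h_F R_F ≥ c√D/(2 log d)` (`classNumber_mul_regulator_ge_of_residue_ge`) the estimate `final_arith` gives
probability `≥ 1/((n+2)^15 + 1)` for `n ≥ ⌈98304/c⌉₊ + 3`.
-/


set_option linter.dupNamespace false -- D-0017: single-problem summit ⇒ QuantumAdvantage.QuantumAdvantage by design

noncomputable section

namespace Summit.QuantumAdvantage.QuantumAdvantage.Theorems.ArithStatLadder.IqThreeMemBQP

open scoped NumberField nonZeroDivisors
open _root_.Computability Literature.Computability.Complexity Literature.Computability.Complexity.Brick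
open Literature.Computability.Cryptography Literature.Computability.QuantumComplexity
open Literature.NumberTheory.QuadraticFields
open Polynomial Finset

/-! ## Helper lemmas -/

/-- `D⁺(d)` read back as a natural number. [folklore] -/
theorem mirrorDisc_toNat (d : ℕ) : ((if 3 ∣ d then ((d / 3 : ℕ) : ℤ) else 3 * (d : ℤ))).toNat = (if 3 ∣ d then d / 3 else 3 * d) := by
  split_ifs
  · exact Int.toNat_natCast _
  · rw [show (3 * (d : ℤ)) = ((3 * d : ℕ) : ℤ) by push_cast; ring]; exact Int.toNat_natCast _

/-- **The validity bridge.** For `d₀` square-free with `fundDiscr d₀ = D` and a pair `(a, b)` with `0 < a`,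
`b² < D`, `4a ∣ D − b²`: the formatted pair `(fmtA, fmtR) = (a, b/2)` (`4 ∣ D`) resp. `(2a, b)` (`4 ∤ D`) has
`0 < fmtA` and `fmtA ∣ fmtR² − d₀`. [cite: JacobsonWilliams2008, Thm. 5.8] -/
theorem fmt_valid {d₀ D a b : ℕ} (hD : (D : ℤ) = Quadratic.fundDiscr d₀) (ha : 0 < a) (hb : b ^ 2 < D)
    (hdvd : 4 * a ∣ D - b ^ 2) :
    0 < (if 4 ∣ D then a else 2 * a) ∧
      ((if 4 ∣ D then a else 2 * a : ℕ) : ℤ) ∣ ((if 4 ∣ D then b / 2 else b : ℕ) : ℤ) ^ 2 - d₀ := by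
  obtain ⟨t, ht⟩ := hdvd
  have ht' : (D : ℤ) - (b : ℤ) ^ 2 = 4 * a * t := by
    have := congrArg (fun n : ℕ => (n : ℤ)) ht; push_cast [Nat.cast_sub hb.le] at this; linarith
  by_cases h4 : d₀ % 4 = 1
  · rw [Quadratic.fundDiscr_of_mod_four_eq_one h4] at hD
    have hDd : D = d₀ := by exact_mod_cast hD
    have hn4 : ¬ 4 ∣ D := by omega
    rw [if_neg hn4, if_neg hn4]
    refine ⟨by omega, Dvd.intro (-(2 * (t : ℤ))) ?_⟩
    push_cast; rw [← hDd]; linarith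
  · rw [Quadratic.fundDiscr_of_mod_four_ne_one h4] at hD
    have hDd : D = 4 * d₀ := by exact_mod_cast hD
    have h4D : 4 ∣ D := ⟨d₀, hDd⟩
    rw [if_pos h4D, if_pos h4D]
    refine ⟨ha, ?_⟩
    have h4b : (2 : ℤ) ∣ (b : ℤ) ^ 2 := ⟨2 * ((d₀ : ℤ) - a * t), by push_cast [hDd] at ht'; linarith⟩
    have h2b : (2 : ℤ) ∣ (b : ℤ) := Int.prime_two.dvd_of_dvd_pow h4b
    obtain ⟨b', hb'⟩ : 2 ∣ b := by exact_mod_cast h2b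
    subst hb'
    rw [Nat.mul_div_cancel_left _ two_pos]
    refine Dvd.intro (-(t : ℤ)) ?_
    push_cast [hDd] at ht' ⊢; linarith

/-- **The elementary estimate of the yes side.** [folklore] -/
theorem final_arith {c : ℝ} (hc : 0 < c) {n d D : ℕ} (hn : ⌈98304 / c⌉₊ + 3 ≤ n) (hdn : d < 2 ^ n) (hd : 4 ≤ d)
    (hD1 : 1 ≤ D) (hD3 : D ≤ 3 * d) {h S3 GR K' ℓ k : ℕ} {R : ℝ} (hR0 : 0 ≤ R)
    (hR : c * Real.sqrt D / (2 * Real.log d) ≤ h * R) (hstat : 2 * h ≤ 3 * S3)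
    (hGR : (S3 : ℝ) * (R / Real.log (2 * Real.sqrt D)) - 2 * (Real.sqrt D * (1 + Real.log D) ^ 3) / K' ≤ GR)
    (hK' : n ^ 6 ≤ K') (hℓ : (2 : ℝ) ^ ℓ ≤ 4 * Real.sqrt D) (hk : (2 : ℝ) ^ k ≤ 4096 * (n : ℝ) ^ 12) :
    1 / ((((n + 2) ^ 15 : ℕ) : ℝ) + 1) ≤ (GR : ℝ) / 2 ^ (ℓ + k) := by
  have hn3 : (3 : ℝ) ≤ n := by exact_mod_cast le_of_add_le_right hn
  have hcn : 98304 ≤ c * n := by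
    have h1 : (⌈98304 / c⌉₊ : ℝ) ≤ n := by exact_mod_cast le_of_add_le_left hn
    have h2 : 98304 / c ≤ n := (Nat.le_ceil _).trans h1
    rwa [div_le_iff₀' hc] at h2
  have hsD : 1 ≤ Real.sqrt D := by
    rw [show (1 : ℝ) = Real.sqrt 1 from Real.sqrt_one.symm]
    exact Real.sqrt_le_sqrt (by exact_mod_cast hD1)
  have hlog2 : Real.log 2 ≤ 1 := by linarith [Real.log_le_sub_one_of_pos (show (0 : ℝ) < 2 by norm_num)]
  have hlog3 : Real.log 3 ≤ 2 := by linarith [Real.log_le_sub_one_of_pos (show (0 : ℝ) < 3 by norm_num)]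
  -- `log d ≤ n`, `0 < log d`
  have hLd0 : 0 < Real.log d := Real.log_pos (by exact_mod_cast (show 1 < d by omega))
  have hLd : Real.log d ≤ n := by
    have h1 : Real.log d ≤ Real.log ((2 : ℝ) ^ n) :=
      Real.log_le_log (by exact_mod_cast (show 0 < d by omega)) (by exact_mod_cast hdn.le)
    rw [Real.log_pow] at h1
    nlinarith [Real.log_pos (show (1 : ℝ) < 2 by norm_num)]
  -- `log D ≤ n + 2`, `0 ≤ log D`, `0 < log (2√D) ≤ n + 2`
  have hLD0 : 0 ≤ Real.log D := Real.log_nonneg (by exact_mod_cast hD1)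
  have hLD : Real.log D ≤ n + 2 := by
    have h1 : Real.log D ≤ Real.log (3 * (2 : ℝ) ^ n) :=
      Real.log_le_log (by exact_mod_cast (show 0 < D by omega)) (by
        have : (D : ℝ) ≤ 3 * d := by exact_mod_cast hD3
        have : (d : ℝ) ≤ 2 ^ n := by exact_mod_cast hdn.le
        nlinarith)
    rw [Real.log_mul (by norm_num) (by positivity), Real.log_pow] at h1
    nlinarith [Real.log_pos (show (1 : ℝ) < 2 by norm_num)]
  have hL2 : Real.log (2 * Real.sqrt D) = Real.log 2 + Real.log D / 2 := by
    rw [Real.log_mul (by norm_num) (by positivity), Real.log_sqrt (by positivity)]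
  have hL20 : 0 < Real.log (2 * Real.sqrt D) := Real.log_pos (by linarith)
  have hL2le : Real.log (2 * Real.sqrt D) ≤ n + 2 := by rw [hL2]; linarith
  -- the good term
  set A : ℝ := c * Real.sqrt D with hA
  have hA0 : 0 < A := by positivity
  have hhR : A / (2 * Real.log d) ≤ h * R := hR
  have hgood : A / (3 * ((n : ℝ) * (n + 2))) ≤ (S3 : ℝ) * (R / Real.log (2 * Real.sqrt D)) := by
    have hS3 : (2 : ℝ) * h ≤ 3 * S3 := by exact_mod_cast hstat
    have h1 : A / (3 * (Real.log d * Real.log (2 * Real.sqrt D))) ≤ (S3 : ℝ) * (R / Real.log (2 * Real.sqrt D)) := by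
      rw [div_le_iff₀ (by positivity)]
      have h2 : A ≤ h * R * (2 * Real.log d) := (div_le_iff₀ (by positivity)).1 hhR
      have h3 : (S3 : ℝ) * (R / Real.log (2 * Real.sqrt D)) * (3 * (Real.log d * Real.log (2 * Real.sqrt D))) =
          3 * S3 * R * Real.log d := by field_simp
      rw [h3]
      nlinarith [mul_nonneg hR0 hLd0.le]
    refine le_trans ?_ h1
    exact div_le_div_of_nonneg_left hA0.le (by positivity)
      (mul_le_mul_of_nonneg_left (mul_le_mul hLd hL2le hL20.le (by positivity)) (by norm_num))
  -- the lost term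
  have hn0 : (0 : ℝ) < n := by linarith
  have hK'r : ((n : ℝ)) ^ 6 ≤ K' := by exact_mod_cast hK'
  have hK'0 : (0 : ℝ) < K' := lt_of_lt_of_le (by positivity) hK'r
  have hlost : 2 * (Real.sqrt D * (1 + Real.log D) ^ 3) / K' ≤ 2 * (Real.sqrt D * (n + 3) ^ 3) / (n : ℝ) ^ 6 := by
    have h1 : (1 + Real.log D) ^ 3 ≤ ((n : ℝ) + 3) ^ 3 := pow_le_pow_left₀ (by linarith) (by linarith) 3
    calc 2 * (Real.sqrt D * (1 + Real.log D) ^ 3) / K' ≤ 2 * (Real.sqrt D * (n + 3) ^ 3) / K' := by gcongr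
      _ ≤ 2 * (Real.sqrt D * (n + 3) ^ 3) / (n : ℝ) ^ 6 := by gcongr
  -- the retained term is at least half the good term
  have hhalf : 2 * (Real.sqrt D * (n + 3) ^ 3) / (n : ℝ) ^ 6 ≤ A / (6 * ((n : ℝ) * (n + 2))) := by
    rw [div_le_div_iff₀ (by positivity) (by positivity), hA]
    have h1 : ((n : ℝ) + 2) ≤ 2 * n := by linarith
    have h2 : ((n : ℝ) + 3) ≤ 2 * n := by linarith
    have h2' : ((n : ℝ) + 3) ^ 3 ≤ (2 * n) ^ 3 := pow_le_pow_left₀ (by positivity) h2 3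
    have h192 : (192 : ℝ) ≤ c * n := by linarith
    calc 2 * (Real.sqrt D * (n + 3) ^ 3) * (6 * ((n : ℝ) * (n + 2)))
        = 12 * Real.sqrt D * (((n : ℝ) + 3) ^ 3 * ((n : ℝ) * (n + 2))) := by ring
      _ ≤ 12 * Real.sqrt D * ((2 * n) ^ 3 * ((n : ℝ) * (2 * n))) := by gcongr
      _ = 192 * (Real.sqrt D * (n : ℝ) ^ 5) := by ring
      _ ≤ (c * n) * (Real.sqrt D * (n : ℝ) ^ 5) := mul_le_mul_of_nonneg_right h192 (by positivity)
      _ = c * Real.sqrt D * (n : ℝ) ^ 6 := by ring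
  have hrel : A / (3 * ((n : ℝ) * (n + 2))) = 2 * (A / (6 * ((n : ℝ) * (n + 2)))) := by
    field_simp; ring
  have hGR' : A / (6 * ((n : ℝ) * (n + 2))) ≤ GR := by linarith
  -- divide by the number of coin patterns
  have hpow : (2 : ℝ) ^ (ℓ + k) ≤ 16384 * Real.sqrt D * (n : ℝ) ^ 12 := by
    rw [pow_add]
    calc (2 : ℝ) ^ ℓ * 2 ^ k ≤ (4 * Real.sqrt D) * (4096 * (n : ℝ) ^ 12) :=
          mul_le_mul hℓ hk (by positivity) (by positivity)
      _ = 16384 * Real.sqrt D * (n : ℝ) ^ 12 := by ring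
  have hstep : A / (6 * ((n : ℝ) * (n + 2))) / (16384 * Real.sqrt D * (n : ℝ) ^ 12) ≤ (GR : ℝ) / 2 ^ (ℓ + k) :=
    div_le_div₀ (le_trans (by positivity) hGR') hGR' (by positivity) hpow
  refine le_trans ?_ hstep
  rw [hA, div_div, div_le_div_iff₀ (by positivity) (by positivity), one_mul]
  have hpow14 : (n : ℝ) ^ 14 ≤ ((n : ℝ) + 2) ^ 14 := pow_le_pow_left₀ (by positivity) (by linarith) 14
  calc 6 * ((n : ℝ) * (n + 2)) * (16384 * Real.sqrt D * (n : ℝ) ^ 12)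
      = 98304 * ((n : ℝ) ^ 13 * (n + 2) * Real.sqrt D) := by ring
    _ ≤ (c * n) * ((n : ℝ) ^ 13 * (n + 2) * Real.sqrt D) := mul_le_mul_of_nonneg_right hcn (by positivity)
    _ = c * Real.sqrt D * ((n : ℝ) ^ 14 * (n + 2)) := by ring
    _ ≤ c * Real.sqrt D * (((n : ℝ) + 2) ^ 14 * (n + 2) + 1) := by
        refine mul_le_mul_of_nonneg_left ?_ (by positivity)
        nlinarith
    _ = c * Real.sqrt D * ((((n + 2) ^ 15 : ℕ) : ℝ) + 1) := by push_cast; ring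

/-- On the promise, `d ≥ 4`. [folklore] -/
theorem four_le_of_isNegFund {d : ℕ} (hd : (((-(d:ℤ)) % 4 = 1 ∧ Squarefree (-(d:ℤ)) ∧ (-(d:ℤ)) ≠ 1) ∨
      (4 ∣ (-(d:ℤ)) ∧ ((-(d:ℤ)) / 4 % 4 = 2 ∨ (-(d:ℤ)) / 4 % 4 = 3) ∧ Squarefree ((-(d:ℤ)) / 4)))) (hd3 : d ≠ 3) :
    4 ≤ d := by
  rcases hd with ⟨h1, -, h3⟩ | ⟨h4, h2, -⟩ <;> omega

/-! ## The registered stub (signature verbatim) -/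

/-- **S6b `stub_realWitnessOfParts`** (XL; test T3, the real torsion-witness sampler). S6a → S5 → for every `c > 0`
the real-side promise problem (yes: `−d` fundamental, `d ≠ 3`, `#Cl₃(D⁺) ≠ 1`, every quadratic `F` of discriminant
`D⁺` has `κ_F ≥ c/log d`; no: `−d` fundamental, `d ≠ 3`, `#Cl₃(D⁺) = 1`) is in `PromiseBQP` — one-sided trials of
the reduced-ideal sampler against the guarded order-bit language (module docstring). -/
theorem stub_realWitnessOfParts :
    (∀ (F : Type) [Field F] [NumberField F], Module.finrank ℚ F = 2 → 0 < NumberField.discr F →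
      ∀ (m : ℕ) (α : 𝓞 F), Squarefree m → 2 ≤ m → (α : F) ^ 2 = (m : F) →
        ∀ C : ClassGroup (𝓞 F),
          NumberField.Units.regulator F / Real.log (2 * Real.sqrt (NumberField.discr F : ℝ)) ≤
            Nat.card {ab : ℕ × ℕ //
              (0 < ab.1 ∧ 0 < ab.2 ∧ ab.2 ^ 2 < (NumberField.discr F).toNat ∧
                4 * ab.1 ∣ (NumberField.discr F).toNat - ab.2 ^ 2 ∧
                (NumberField.discr F).toNat < (2 * ab.1 + ab.2) ^ 2 ∧
                (2 * ab.1 ≤ ab.2 ∨ (2 * ab.1 - ab.2) ^ 2 < (NumberField.discr F).toNat)) ∧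
              ∃ hI : Ideal.span {((if 4 ∣ (NumberField.discr F).toNat then ab.1 else 2 * ab.1 : ℕ) : 𝓞 F),
                  ((if 4 ∣ (NumberField.discr F).toNat then ab.2 / 2 else ab.2 : ℕ) : 𝓞 F) + α} ∈
                    (Ideal (𝓞 F))⁰,
                ClassGroup.mk0 ⟨_, hI⟩ = C}) →
    (IsQSolvable fun x : List Bool =>
      {y | ∀ (F : Type) [Field F] [NumberField F] (m a r : ℕ) (α : 𝓞 F),
        x = boolPair (encodeNat m) (boolPair (encodeNat a) (encodeNat r)) →
          Squarefree m → 2 ≤ m → Module.finrank ℚ F = 2 → (α : F) ^ 2 = (m : F) → 0 < a →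
            (a : ℤ) ∣ (r : ℤ) ^ 2 - m →
              ∀ hI : Ideal.span {(a : 𝓞 F), (r : 𝓞 F) + α} ∈ (Ideal (𝓞 F))⁰,
                ∃ t : List Bool, y = boolPair (encodeNat (orderOf (ClassGroup.mk0 ⟨_, hI⟩))) t}) →
      ∀ c : ℝ, 0 < c →
        (⟨encodingNatBool.toLanguage {d : ℕ | IsNegFundamentalDiscr d ∧ d ≠ 3 ∧
            quadFieldThreeTorsion (if 3 ∣ d then ((d / 3 : ℕ) : ℤ) else 3 * (d : ℤ)) ≠ 1 ∧
            ∀ (F : Type) [Field F] [NumberField F], Module.finrank ℚ F = 2 →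
              NumberField.discr F = (if 3 ∣ d then ((d / 3 : ℕ) : ℤ) else 3 * (d : ℤ)) →
                c / Real.log d ≤ NumberField.dedekindZeta_residue F},
          encodingNatBool.toLanguage {d : ℕ | IsNegFundamentalDiscr d ∧ d ≠ 3 ∧
            quadFieldThreeTorsion (if 3 ∣ d then ((d / 3 : ℕ) : ℤ) else 3 * (d : ℤ)) = 1}⟩ : PromiseProblem) ∈ PromiseBQP := by
  intro hR1 hS5 c hc
  classical
  obtain ⟨tq, htqBQP, htqShape, htqHit⟩ := trial_exists
  have hL5 := orderBitLang_mem_BQP hS5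
  have hT := htqBQP _ hL5
  refine mem_PromiseBQP_of_oneSided_trials _ ?_ hT (13 * X + 3) ((X + 2) ^ 15) (⌈98304 / c⌉₊ + 3) ?_ ?_
  · -- disjoint promise
    refine Set.disjoint_left.2 fun x hx hx' => ?_
    obtain ⟨d, hd, rfl⟩ := hx
    obtain ⟨d', hd', he⟩ := hx'
    exact hd.2.2.1 ((encodingNatBool.encode_injective he : d' = d) ▸ hd'.2.2)
  · -- yes side
    rintro x ⟨d, ⟨hd, hd3, htors, hres⟩, rfl⟩ hn
    rw [show (encodingNatBool.encode d : List Bool) = encodeNat d from rfl] at hn ⊢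
    -- the field of discriminant `D⁺` and `α = √d₀`
    obtain ⟨F, _, _, h2, hdisc⟩ := exists_numberField_discr_eq_mirrorDisc hd hd3
    obtain ⟨hsf, hd₀2, hfd⟩ := mirrorRadicand_spec hd hd3
    have hpos : 0 < NumberField.discr F := by rw [hdisc]; exact mirrorDisc_pos hd hd3
    obtain ⟨α, hα⟩ := exists_ringOfIntegers_sq_eq h2 (hdisc.trans hfd.symm)
    set D : ℕ := (NumberField.discr F).toNat with hDdef
    have hDd : D = (if 3 ∣ d then d / 3 else 3 * d) := by rw [hDdef, hdisc, mirrorDisc_toNat]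
    have hDZ : (D : ℤ) = NumberField.discr F := Int.toNat_of_nonneg hpos.le
    have hDR : (NumberField.discr F : ℝ) = (D : ℝ) := by exact_mod_cast hDZ.symm
    have hDfd : (D : ℤ) = Quadratic.fundDiscr (mirrorRadicand d) := by rw [hDZ, hdisc, hfd]
    -- sizes
    set n := (encodeNat d).length with hndef
    have hnsize : n = d.size := TM2Pass.length_encodeNat_eq_size d
    have hd4 : 4 ≤ d := four_le_of_isNegFund hd hd3
    have hdn : d < 2 ^ n := hnsize ▸ Nat.lt_size_self d
    have hD1 : 1 ≤ D := by rw [hDd]; split_ifs <;> omega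
    have hD3 : D ≤ 3 * d := by rw [hDd]; split_ifs <;> omega
    have hn3 : 3 ≤ n := le_of_add_le_right hn
    have hDlt : D < 2 ^ (n + 2) := by
      calc D ≤ 3 * d := hD3
        _ < 4 * 2 ^ n := by omega
        _ = 2 ^ (n + 2) := by rw [pow_add]; ring
    -- class-group data: `3 ∣ h`, the torsion statistic, the brightness bound on `h R`
    have h3h : 3 ∣ Fintype.card (ClassGroup (𝓞 F)) := three_dvd_card_classGroup_of_torsion_ne_one htors F h2 hdisc
    have hstat := Literature.GroupTheory.FiniteAbelian.two_mul_card_le_three_mul_card_filter_three_dvd_orderOf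
      (ClassGroup (𝓞 F)) h3h
    have hlogd : 0 < Real.log d := Real.log_pos (by exact_mod_cast (show 1 < d by omega))
    have hR := classNumber_mul_regulator_ge_of_residue_ge F h2 hpos hlogd (hres F h2 hdisc)
    rw [hDR] at hR
    -- the good reduced pairs
    have hK'pos : 0 < 2 ^ (6 * n.size) := by positivity
    obtain ⟨GR, hGRp, hGRc⟩ := exists_goodPairs h2 hpos α (hR1 F h2 hpos (mirrorRadicand d) α hsf hd₀2 hα) hK'pos
    rw [hDR] at hGRc
    -- the trial's hits, for this `d`
    have hHit := htqHit d
    rw [← hDd] at hHit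
    have hMa : ∀ ab ∈ GR, (D - ab.2 ^ 2) / 4 ≠ 0 ∧ ab.1 ∣ (D - ab.2 ^ 2) / 4 := by
      intro ab hab
      obtain ⟨⟨ha, -, hb, h4a, -⟩, -⟩ := hGRp ab hab
      have hle : 4 * ab.1 ≤ D - ab.2 ^ 2 := Nat.le_of_dvd (by omega) h4a
      refine ⟨fun h0 => ?_, ⟨_, RealReducedPairs.quarter_eq_mul ha h4a⟩⟩
      have := (Nat.div_eq_zero_iff_lt (by norm_num : 0 < 4)).1 h0; omega
    set J : ℕ × ℕ → ℕ := fun ab => if h : (D - ab.2 ^ 2) / 4 ≠ 0 ∧ ab.1 ∣ (D - ab.2 ^ 2) / 4 then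
      Classical.choose (hHit ab.2 ab.1 h.1 h.2) else 0 with hJ
    have hJspec : ∀ ab ∈ GR, J ab < ((D - ab.2 ^ 2) / 4).divisors.card ∧ ∀ z : List Bool,
        bitsToNat (z.take ((Nat.sqrt D).size + 1)) = ab.2 →
        bitsToNat ((z.drop ((Nat.sqrt D).size + 1)).take (12 * (encodeNat d).length.size)) = J ab →
        tq (encodeNat d) z = boolPair (encodeNat (mirrorRadicand d)) (boolPair (encodeNat (if 4 ∣ D then ab.1 else 2 * ab.1)) (encodeNat (if 4 ∣ D then ab.2 / 2 else ab.2))) := by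
      intro ab hab
      have h := hMa ab hab
      simp only [hJ, dif_pos h]
      exact Classical.choose_spec (hHit ab.2 ab.1 h.1 h.2)
    -- lengths of the two coin fields
    set ℓ : ℕ := (Nat.sqrt D).size + 1 with hℓdef
    set k : ℕ := 12 * n.size with hkdef
    have hsD1 : 1 ≤ Nat.sqrt D := Nat.sqrt_pos.2 (by omega)
    have hsz : 2 ^ (Nat.sqrt D).size ≤ 2 * Nat.sqrt D := GoldwasserSipser.two_pow_size_le hsD1
    have hszn : 2 ^ n.size ≤ 2 * n := GoldwasserSipser.two_pow_size_le (by omega)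
    have hℓn : ℓ ≤ n + 3 := by
      have h1 : (Nat.sqrt D).size ≤ D.size := Nat.size_le_size (Nat.sqrt_le_self D)
      have h2 : D.size ≤ n + 2 := Nat.size_le.2 hDlt
      omega
    have hkn : k ≤ 12 * n := by have : n.size ≤ n := Nat.size_le.2 (Nat.lt_two_pow_self); omega
    have hβ : ℓ + k ≤ (13 * X + 3 : Polynomial ℕ).eval n := by simp only [eval_add, eval_mul, eval_X, eval_ofNat]; omega
    -- the estimate `1/(n+2)^15 ≤ #GR/2^(ℓ+k)`
    have hK' : n ^ 6 ≤ 2 ^ (6 * n.size) := by rw [pow_mul']; exact Nat.pow_le_pow_left (Nat.lt_size_self n).le 6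
    have hℓr : (2 : ℝ) ^ ℓ ≤ 4 * Real.sqrt D := by
      have h1 : 2 ^ ℓ ≤ 4 * Nat.sqrt D := by rw [hℓdef, pow_succ]; omega
      have h2 : ((2 ^ ℓ : ℕ) : ℝ) ≤ 4 * (Nat.sqrt D : ℝ) := by exact_mod_cast h1
      push_cast at h2
      linarith [(Real.nat_sqrt_le_real_sqrt : ((Nat.sqrt D : ℕ) : ℝ) ≤ Real.sqrt D)]
    have hkr : (2 : ℝ) ^ k ≤ 4096 * (n : ℝ) ^ 12 := by
      have h1 : 2 ^ k ≤ 4096 * n ^ 12 := by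
        calc 2 ^ k = (2 ^ n.size) ^ 12 := by rw [hkdef, pow_mul']
          _ ≤ (2 * n) ^ 12 := Nat.pow_le_pow_left hszn 12
          _ = 4096 * n ^ 12 := by ring
      exact_mod_cast h1
    have hfin := final_arith hc hn hdn hd4 hD1 hD3 (NumberField.Units.regulator_pos F).le
      (h := Fintype.card (ClassGroup (𝓞 F))) (by simpa [NumberField.classNumber] using hR) hstat hGRc hK' hℓr hkr
    have hN : ((X + 2) ^ 15 : Polynomial ℕ).eval n = (n + 2) ^ 15 := by simp only [eval_pow, eval_add, eval_X, eval_ofNat]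
    rw [hN]
    -- the coin injection
    refine hfin.trans (coin_injection GR J ℓ k _ hβ _ (fun ab hab => ?_) (fun ab hab ab' hab' hb hj => ?_)
      (fun ab hab z hz hzb hzj => ?_))
    · -- field sizes
      obtain ⟨⟨-, -, hb, -⟩, -, hτ⟩ := hGRp ab hab
      constructor
      · have hbs : ab.2 ≤ Nat.sqrt D := by
          by_contra hlt; exact absurd hb (not_lt.2 (Nat.sqrt_lt'.1 (not_le.1 hlt)).le)
        calc ab.2 ≤ Nat.sqrt D := hbs
          _ < 2 ^ (Nat.sqrt D).size := Nat.lt_size_self _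
          _ < 2 ^ ℓ := Nat.pow_lt_pow_right (by norm_num) (by omega)
      · calc J ab < ((D - ab.2 ^ 2) / 4).divisors.card := (hJspec ab hab).1
          _ ≤ (2 ^ (6 * n.size)) ^ 2 := hτ
          _ = 2 ^ k := by rw [← pow_mul, hkdef]; ring_nf
    · -- injectivity of `(b, J)`
      obtain ⟨hj1, hz1⟩ := hJspec ab hab
      obtain ⟨-, hz2⟩ := hJspec ab' hab'
      obtain ⟨⟨-, -, hb1, -⟩, -, hτ1⟩ := hGRp ab hab
      have hbs : ab.2 ≤ Nat.sqrt D := by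
        by_contra hlt; exact absurd hb1 (not_lt.2 (Nat.sqrt_lt'.1 (not_le.1 hlt)).le)
      have hblt : ab.2 < 2 ^ ℓ :=
        calc ab.2 ≤ Nat.sqrt D := hbs
          _ < 2 ^ (Nat.sqrt D).size := Nat.lt_size_self _
          _ < 2 ^ ℓ := Nat.pow_lt_pow_right (by norm_num) (by omega)
      have hjlt : J ab < 2 ^ k :=
        calc J ab < ((D - ab.2 ^ 2) / 4).divisors.card := hj1
          _ ≤ (2 ^ (6 * n.size)) ^ 2 := hτ1
          _ = 2 ^ k := by rw [← pow_mul, hkdef]; ring_nf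
      have hf := take_fields ℓ k ab.2 (J ab) []
      have ht1 := hz1 _ (by rw [hf.1, bitsToNat_natBits hblt]) (by rw [hf.2, bitsToNat_natBits hjlt])
      have ht2 := hz2 _ (by rw [hf.1, bitsToNat_natBits hblt, hb]) (by rw [hf.2, bitsToNat_natBits hjlt, hj])
      obtain ⟨-, ha12, -⟩ := triple_inj (ht1.symm.trans ht2)
      refine Prod.ext ?_ hb
      split_ifs at ha12 <;> omega
    · -- every such coin string hits `L₅`
      obtain ⟨⟨ha, hb0, hb, h4a, hred⟩, ⟨hI, h3⟩, -⟩ := hGRp ab hab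
      obtain ⟨hfpos, hfdvd⟩ := fmt_valid hDfd ha hb h4a
      show tq (fstF (boolPair (encodeNat d) z)) (sndF (boolPair (encodeNat d) z)) ∈
        ({x : List Bool | x ∈ ({x : List Bool | ∃ m a r : ℕ, x = boolPair (encodeNat m) (boolPair (encodeNat a) (encodeNat r)) ∧ Squarefree m ∧ 2 ≤ m ∧ 0 < a ∧ (a : ℤ) ∣ (r : ℤ) ^ 2 - m} : Set (List Bool)) ∧
          x ∈ ({x : List Bool | ∀ (F : Type) [Field F] [NumberField F] (m a r : ℕ) (α : 𝓞 F),
      x = boolPair (encodeNat m) (boolPair (encodeNat a) (encodeNat r)) → Squarefree m → 2 ≤ m →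
        Module.finrank ℚ F = 2 → (α : F) ^ 2 = (m : F) → 0 < a → (a : ℤ) ∣ (r : ℤ) ^ 2 - m →
          ∀ hI : Ideal.span {(a : 𝓞 F), (r : 𝓞 F) + α} ∈ (Ideal (𝓞 F))⁰, 3 ∣ orderOf (ClassGroup.mk0 ⟨_, hI⟩)} : Set (List Bool))} : Set (List Bool))
      rw [fstF_boolPair, sndF_boolPair, (hJspec ab hab).2 z hzb hzj]
      exact ⟨⟨_, _, _, rfl, hsf, hd₀2, hfpos, hfdvd⟩, (mem_yes_iff hsf hd₀2 h2 hα hfpos hfdvd hI).2 h3⟩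
  · -- no side
    rintro x ⟨d, ⟨hd, hd3, htors⟩, rfl⟩ z hz
    change tq (fstF (boolPair (encodeNat d) z)) (sndF (boolPair (encodeNat d) z)) ∈
      ({x : List Bool | x ∈ ({x : List Bool | ∃ m a r : ℕ, x = boolPair (encodeNat m) (boolPair (encodeNat a) (encodeNat r)) ∧ Squarefree m ∧ 2 ≤ m ∧ 0 < a ∧ (a : ℤ) ∣ (r : ℤ) ^ 2 - m} : Set (List Bool)) ∧
          x ∈ ({x : List Bool | ∀ (F : Type) [Field F] [NumberField F] (m a r : ℕ) (α : 𝓞 F),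
      x = boolPair (encodeNat m) (boolPair (encodeNat a) (encodeNat r)) → Squarefree m → 2 ≤ m →
        Module.finrank ℚ F = 2 → (α : F) ^ 2 = (m : F) → 0 < a → (a : ℤ) ∣ (r : ℤ) ^ 2 - m →
          ∀ hI : Ideal.span {(a : 𝓞 F), (r : 𝓞 F) + α} ∈ (Ideal (𝓞 F))⁰, 3 ∣ orderOf (ClassGroup.mk0 ⟨_, hI⟩)} : Set (List Bool))} : Set (List Bool)) at hz
    rw [fstF_boolPair, sndF_boolPair] at hz
    obtain ⟨u, v, huv⟩ := htqShape (encodeNat d) z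
    rw [huv, bitsToNat_encodeNat] at hz
    obtain ⟨⟨m, a, r, heq, hsf, hm, ha, hdvd⟩, hyes⟩ := hz
    obtain ⟨hm', -, -⟩ := triple_inj heq
    subst hm'
    obtain ⟨F, _, _, h2, hdisc⟩ := exists_numberField_discr_eq_mirrorDisc hd hd3
    obtain ⟨-, -, hfd⟩ := mirrorRadicand_spec hd hd3
    obtain ⟨α, hα⟩ := exists_ringOfIntegers_sq_eq h2 (hdisc.trans hfd.symm)
    have hI := span_pair_natCast_mem_nonZeroDivisors ha ((r : 𝓞 F) + α)
    exact not_three_dvd_orderOf_of_torsion_eq_one htors F h2 hdisc _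
      (hyes F (mirrorRadicand d) a r α heq hsf hm h2 hα ha hdvd hI)

end Summit.QuantumAdvantage.QuantumAdvantage.Theorems.ArithStatLadder.IqThreeMemBQP

end
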